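import Literature.AnabelianGeometry.EtaleTheta.SettingModelTateInversion
import Literature.AnabelianGeometry.EtaleTheta.SettingModelSigmaHatFacts
import Literature.AnabelianGeometry.EtaleTheta.SettingModelChiCuspInertiaNotTheta
import Literature.AnabelianGeometry.EtaleTheta.Discharge.Sec1ThetaCompanionOfAut
import HarnessLib

/-!
# NV TRUTH VALUES of the [EtTh] §2 census clauses at the STAGE-2 («Tate shear») models `curveχq` / `curveχq′`
# — (R1e′) HOLDS for the cocycle-corrected inversion, (P1) HOLDS, the inertia clause FAILS at the cusp datum

S. Mochizuki, *The étale theta function and its Frobenioid-theoretic manifestations*, Publ. RIMS **45**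
(2009) [EtTh], §2 pp. 35–37 (printed 261–263): Def. 2.1 and the discussion before it («`I_x ⊆ D_x`
isomorphically onto `Δ̄_Θ`»), «`ι` … “multiplication by `−1`”», Prop. 2.2 (i) («eigenvalues `−1` and `1`»)
[cite: MochizukiEtTh2009, Prop 2.2 (i) p.37].

Cell abc-iut, layer L2, seat abc-iut-L2-t10 (gen 5): the STAGE-2 companion of the R208 census table
`SettingModelChiCensusClauses` (p436289, stage-1 `modelχ`/`modelχ′`). Carriers (abc-iut-w5-d249, R78 stage 2,
integrator abc-iut-L6-d6): `curveχq p i j` (`SettingModelTateSemidirect`: `Π^tp_X = Γ ⋊_{affTwist₃ ∘ ρ_{i,j}}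
G_{ℚ_p}`, `Π_X = F̂₂ ⋊ G_{ℚ_p}`), its cusped variant `curveχq′ p i j` (`SettingModelTateCusp`: synthetic TORAL cusp
`D_x = b^Ẑ ⋊ G_{ℚ_p}`), and the cocycle-corrected inversion `inversionχq p i j` (`SettingModelTateInversion`,
p436210: `(γ, g) ↦ (ι_Γ γ · (b^{d(ρ g)}, 0), g)`, restricting to `ι_Γ` on `Γ`). The `ThetaSetting` over them
(F5q `modelχq`, abc-iut-L2-t5) is not needed: every clause below lives on the `TemperedCurve` layer and lifts to
any `ThetaSetting`/`MuTwoSetting` over it by `rfl`. PROOF-ONLY (0 definitions). TABLE: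

| clause (binder) | curveχq | curveχq′ | decl |
|---|---|---|---|
| (R1e′) «`ι̂ ≡ −1` on `Δ_X^ab`» for `ι := inversionχq p i j` (origin clause of hιell, G-L2t10-4 (a)) | HOLDS | HOLDS | `inversionχq_hinv`, `inversionχq_hinv'` (+ riders BY NAME from p436210: `inversionχq_facets`) |
| (P1) «`Ker(Π_X → G_K) = Δ̂_X`» | HOLDS | HOLDS | already in the tree: `ker_augHat_eq_deltaHat_curveχq` (`SettingModelTateGroupLevel`), `ker_augHat_eq_deltaHat_curveχq'` (`SettingModelTateCuspGroupLevel`) — cited, not restated |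
| «`ι` normalises the cusp's decomposition group» (X-side of (B2)) | n/a | HOLDS | p436210 `inversionχq_mem_cuspDecompχq_iff` (cited; the section is MOVED by the Kummer cocycle, `inversionχq_inr`) |
| inertia clause «`toHat(I_x) ⊔ barKerOf Δ̂ l = barThetaOf Δ̂ l`» (§1 side of hIx, G-L2t10-3) | NOT-INSTANTIABLE (`Pt = ∅`) | FAILS ∀ `l ≥ 2` | `isEmpty_pt_curveχq`, `not_inertiaClause_curveχq'` (same `b`-exponent-mod-`l` certificate as `SettingModelChiCuspInertiaNotTheta`) |
| hΘ, hιell/hιtheta/hIx consumer forms, (B1)–(B3), hC1 | NOT-INSTANTIABLE (no `ThetaSetting`/`MuTwoSetting`/`CLevelData`/`TemperedCoverData` over the stage-2 carriers yet) | same | producers ready: hΘ ⟸ `IsEtThOrigin.commutator_sup_barKerHat` once `modelχq` lands (`isFreeProfiniteOnTwo_deltaHatχq`); hιell ⟸ (R1e′) row 1 via `CLevelData.piCData_inv_ell_of_hinv` (p432126); hIx blocked at the toral cusp (row 4) |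

ROUTE for (R1e′) (no global formula for the completed cocycle-corrected inversion needed): `{z | ι̂ z · z ∈
⁅Δ̂_X,Δ̂_X⁆⁻}` is closed and contains the dense `toHat(Δ^tp_X) = inl(pr₁ Γ)`, where `ι(inl γ) = inl(ι_Γ γ)`
(`inversionχq_inl`) gives `ι̂(inl γ₁)·inl γ₁ = inl(σ̂ γ₁ · γ₁) ∈ inl(⁅F̂₂,F̂₂⁆⁻)` (abc-iut-w5-d072's
`sigmaHat_mul_self_mem_closure_commutator`). HONEST LIMITS: stage-2 semi-synthetic models, consistency evidence
only; NOT-INSTANTIABLE = carrier not constructed in the tree; nothing of [EtTh] asserted; no new `Prop` fact;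
zero edit of any other seat's file; no side is taken on [IUTchIII] Cor. 3.12; typed ≠ proved.
-/

noncomputable section

namespace Literature.AnabelianGeometry.EtaleTheta.SettingModel

open scoped commutatorElement
open Literature.AnabelianGeometry.SemiGraphs _root_.Topology _root_.Function

variable (p : ℕ) [Fact p.Prime] (i j : ℤ)

/-! ## §1. (R1e′) for the cocycle-corrected inversion — HOLDS at both stage-2 carriers -/

/-- `inl : F̂₂ → Π_X` carries `⁅F̂₂, F̂₂⁆⁻` into `⁅Δ̂_X, Δ̂_X⁆⁻` at stage 2 (`inl(F̂₂) ⊆ Δ̂_X`, `inl` continuous).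
[cite: MochizukiEtTh2009, §1 p.12] -/
theorem inl_mem_closure_commutator_deltaHatχq {y : F₂hatT} (hy : y ∈ (commutator F₂hatT).topologicalClosure) :
    (SemidirectProduct.inl y : PiHtχq p i j) ∈
      (⁅(curveχq p i j).DeltaHat, (curveχq p i j).DeltaHat⁆).topologicalClosure := by
  have hle : (commutator F₂hatT).map (SemidirectProduct.inl : F₂hatT →* PiHtχq p i j) ≤
      ⁅(curveχq p i j).DeltaHat, (curveχq p i j).DeltaHat⁆ := by
    rw [commutator_def, Subgroup.map_commutator]
    have h : (⊤ : Subgroup F₂hatT).map (SemidirectProduct.inl : F₂hatT →* PiHtχq p i j) ≤ (curveχq p i j).DeltaHat := by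
      rintro _ ⟨x, -, rfl⟩
      exact inl_mem_deltaHatχq p i j x
    exact Subgroup.commutator_mono h h
  have hsub : (SemidirectProduct.inl : F₂hatT → PiHtχq p i j) '' (commutator F₂hatT : Set F₂hatT) ⊆
      ((⁅(curveχq p i j).DeltaHat, (curveχq p i j).DeltaHat⁆ : Subgroup (PiHtχq p i j)) : Set (PiHtχq p i j)) := by
    rintro _ ⟨x, hx, rfl⟩
    exact hle ⟨x, hx, rfl⟩
  have hmem : (SemidirectProduct.inl y : PiHtχq p i j) ∈
      closure ((SemidirectProduct.inl : F₂hatT → PiHtχq p i j) '' (commutator F₂hatT : Set F₂hatT)) := by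
    refine image_closure_subset_closure_image (Semidirect.continuous_inl (isInducing_leftRightHatχq p i j))
      ⟨y, ?_, rfl⟩
    rwa [← Subgroup.topologicalClosure_coe]
  have key := closure_mono hsub hmem
  rwa [← Subgroup.topologicalClosure_coe] at key

/-- On the dense part: for `x ∈ Δ^tp_X = Γ ⋊ 1`, `toHat(ι x · x) ∈ ⁅Δ̂_X, Δ̂_X⁆⁻` (`x = inl γ`, `ι(inl γ) = inl(ι_Γ γ)`,
`pr₁(ι_Γ γ · γ) = σ̂ γ₁ · γ₁`). [cite: MochizukiEtTh2009, Prop 2.2 (i) p.37] -/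
theorem toHat_inversionχq_mul_self_mem {x : PiTpχq p i j} (hx : x ∈ (curveχq p i j).DeltaTemp) :
    (curveχq p i j).toHat (inversionχq p i j x * x) ∈
      (⁅(curveχq p i j).DeltaHat, (curveχq p i j).DeltaHat⁆).topologicalClosure := by
  have hx1 : x.right = 1 := (mem_deltaTempχq_iff p i j x).mp hx
  have hxe : x = SemidirectProduct.inl x.left := by
    rw [← SemidirectProduct.inl_left_mul_inr_right x, hx1, map_one, mul_one]
    rfl
  rw [hxe, inversionχq_inl, ← map_mul]
  have h : (curveχq p i j).toHat (SemidirectProduct.inl (gfpInv x.left * x.left)) =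
      (SemidirectProduct.inl (sigmaHat (gfpFst x.left) * gfpFst x.left) : PiHtχq p i j) := by
    change toHatχq p i j (SemidirectProduct.inl (gfpInv x.left * x.left)) = _
    refine SemidirectProduct.ext ?_ rfl
    rw [toHatχq_left, SemidirectProduct.left_inl, SemidirectProduct.left_inl, map_mul]
    rfl
  rw [h]
  exact inl_mem_closure_commutator_deltaHatχq p i j (sigmaHat_mul_self_mem_closure_commutator _)

/-- **(R1e′) HOLDS at STAGE 2**: for the cocycle-corrected inversion `ι := inversionχq p i j` of
`Π^tp_X = Γ ⋊_{affTwist₃ ∘ ρ} G_{ℚ_p}`, `ι̂ g · g ∈ ⁅Δ̂_X, Δ̂_X⁆⁻` for every `g ∈ Δ̂_X` — «`ι̂ ≡ −1` on `Δ_X^ab`»,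
the origin clause of the §2 binder hιell (G-L2t10-4 (a)). Closed-set route over the dense `toHat(Δ^tp_X)`.
[cite: MochizukiEtTh2009, Prop 2.2 (i) p.37] -/
theorem inversionχq_hinv :
    ∀ g ∈ (curveχq p i j).DeltaHat,
      (curveχq p i j).completionAut (inversionχq p i j) g * g ∈
        (⁅(curveχq p i j).DeltaHat, (curveχq p i j).DeltaHat⁆).topologicalClosure := by
  set X : TemperedCurve p := curveχq p i j with hX
  set C : Subgroup X.PiHat := (⁅X.DeltaHat, X.DeltaHat⁆).topologicalClosure with hC
  have hS : IsClosed {g : X.PiHat | X.completionAut (inversionχq p i j) g * g ∈ C} :=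
    (Subgroup.isClosed_topologicalClosure _).preimage
      ((X.completionAut (inversionχq p i j)).continuous.mul continuous_id)
  have hsub : ((X.DeltaTemp.map X.toHat.toMonoidHom : Subgroup X.PiHat) : Set X.PiHat) ⊆
      {g : X.PiHat | X.completionAut (inversionχq p i j) g * g ∈ C} := by
    rintro _ ⟨x, hx, rfl⟩
    change X.completionAut (inversionχq p i j) (X.toHat x) * X.toHat x ∈ C
    rw [TemperedCurve.completionAut_toHat, ← map_mul]
    exact toHat_inversionχq_mul_self_mem p i j hx
  intro g hg
  have hg' : g ∈ closure ((X.DeltaTemp.map X.toHat.toMonoidHom : Subgroup X.PiHat) : Set X.PiHat) := by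
    rw [← Subgroup.topologicalClosure_coe]
    exact hg
  exact closure_minimal hsub hS hg'

/-- The (R1) facets of the stage-2 inversion, collected BY NAME from abc-iut-w5-d249's p436210 next to (R1e′): over
`G_K`, `Δ^tp_X`-stable, `Z`-reversing, involutive, nontrivial — and (R1e′). [cite: Mochizuki2012, Rmk 1.4.1 (ii) p.28] -/
theorem inversionχq_facets :
    (∀ x : PiTpχq p i j, augχq p i j (inversionχq p i j x) = augχq p i j x) ∧
      (∀ x : PiTpχq p i j, inversionχq p i j x ∈ (curveχq p i j).DeltaTemp ↔ x ∈ (curveχq p i j).DeltaTemp) ∧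
      (∀ x : PiTpχq p i j, gfpSnd (inversionχq p i j x).left = (gfpSnd x.left)⁻¹) ∧
      (∀ x : PiTpχq p i j, inversionχq p i j (inversionχq p i j x) = x) ∧
      (inversionχq p i j).toMulEquiv ≠ MulEquiv.refl _ ∧
      ∀ g ∈ (curveχq p i j).DeltaHat,
        (curveχq p i j).completionAut (inversionχq p i j) g * g ∈
          (⁅(curveχq p i j).DeltaHat, (curveχq p i j).DeltaHat⁆).topologicalClosure :=
  ⟨augχq_inversionχq p i j, inversionχq_mem_deltaTemp_iff p i j, gfpSnd_left_inversionχq p i j,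
    inversionχq_inversionχq p i j, inversionχq_ne_refl p i j, inversionχq_hinv p i j⟩

/-- **(R1e′) HOLDS at the cusped stage-2 carrier `curveχq′`** (same `Π^tp_X`, `Π_X`, `toHat`, `Δ̂_X`).
[cite: MochizukiEtTh2009, Prop 2.2 (i) p.37] -/
theorem inversionχq_hinv' :
    ∀ g ∈ (curveχq' p i j).DeltaHat,
      (curveχq' p i j).completionAut (inversionχq p i j) g * g ∈
        (⁅(curveχq' p i j).DeltaHat, (curveχq' p i j).DeltaHat⁆).topologicalClosure :=
  inversionχq_hinv p i j

/-! ## §2. The inertia clause is NOT-INSTANTIABLE at `curveχq` and FAILS at `curveχq′` ((P1) is already in the tree) -/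

/-- The inertia clause is NOT-INSTANTIABLE at `curveχq`: no closed point. [cite: MochizukiEtTh2009, Def 2.1 p.35] -/
theorem isEmpty_pt_curveχq : IsEmpty (curveχq p i j).Pt := by
  change IsEmpty PEmpty
  infer_instance

/-- On `Δ̂_X = Ker(right)` of the stage-2 hat group the first projection is multiplicative.
[cite: MochizukiEtTh2009, §1 p.12] -/
theorem left_mul_of_right_eq_one_χq {g : PiHtχq p i j} (hg : g.right = 1) (h : PiHtχq p i j) :
    (g * h).left = g.left * h.left := by
  rw [SemidirectProduct.mul_left, hg, map_one, MulAut.one_apply]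

/-- **`b = inl(η b) ∉ barThetaOf Δ̂_X l` at stage 2, for `l ≥ 2`** — the `b`-exponent modulo `l`
(`level_l ∘ ê_b ∘ left` on `Δ̂_X = Ker right`) kills `[Δ̂,Δ̂]` and `Δ̂^l`, has closed kernel, and is `1` on `b`
(the certificate of `SettingModelChiCuspInertiaNotTheta`, verbatim over the stage-2 hat group).
[cite: MochizukiEtTh2009, Def 2.1 p.35] -/
theorem inl_eta_one_not_mem_barThetaOf_χq (l : ℕ) (hl : 2 ≤ l) :
    (SemidirectProduct.inl (eta (FreeGroup.of 1)) : PiHtχq p i j) ∉ ClassTwoBar.barThetaOf (curveχq p i j).DeltaHat l := by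
  intro hb
  have hl' : 0 < l := by omega
  let L : ℕ+ := ⟨l, hl'⟩
  let φ : (curveχq p i j).DeltaHat →* F₂hatT :=
    { toFun := fun g => (g : PiHtχq p i j).left
      map_one' := SemidirectProduct.one_left
      map_mul' := fun g h => left_mul_of_right_eq_one_χq p i j (right_eq_one_of_mem_deltaHatχq p i j g.2) h }
  let ψ : (curveχq p i j).DeltaHat →* Multiplicative (ZMod L) :=
    (ZHatLevel.level L).comp (eHatB.toMonoidHom.comp φ)
  let K : Subgroup (PiHtχq p i j) := ψ.ker.map (curveχq p i j).DeltaHat.subtype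
  have hmem : ∀ g : PiHtχq p i j, g ∈ K ↔ g ∈ (curveχq p i j).DeltaHat ∧ ZHatLevel.level L (eHatB g.left) = 1 := by
    intro g
    constructor
    · rintro ⟨g', hg', rfl⟩
      exact ⟨g'.2, hg'⟩
    · rintro ⟨hg, h⟩
      exact ⟨⟨g, hg⟩, h, rfl⟩
  have hK : IsClosed (K : Set (PiHtχq p i j)) := by
    have hset : (K : Set (PiHtχq p i j)) = ((curveχq p i j).DeltaHat : Set (PiHtχq p i j)) ∩
        (fun g : PiHtχq p i j => eHatB g.left) ⁻¹' ((ZHatLevel.level L).ker : Set ZH) := by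
      ext g
      rw [SetLike.mem_coe, hmem, Set.mem_inter_iff, Set.mem_preimage, SetLike.mem_coe, SetLike.mem_coe,
        MonoidHom.mem_ker]
    rw [hset]
    refine (Subgroup.isClosed_topologicalClosure _).inter (IsClosed.preimage
      (eHatB.continuous.comp (Semidirect.continuous_left (isInducing_leftRightHatχq p i j))) ?_)
    exact Subgroup.isClosed_of_isOpen _ (ZHatLevel.isOpen_ker_level L)
  have h1 : ⁅(curveχq p i j).DeltaHat, (curveχq p i j).DeltaHat⁆ ≤ K := by
    refine Subgroup.commutator_le.mpr fun u hu v hv => ?_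
    refine ⟨⁅(⟨u, hu⟩ : (curveχq p i j).DeltaHat), ⟨v, hv⟩⁆, ?_, rfl⟩
    rw [SetLike.mem_coe, MonoidHom.mem_ker, map_commutatorElement, commutatorElement_eq_one_iff_commute]
    exact Commute.all _ _
  have h2 : ∀ y ∈ (curveχq p i j).DeltaHat, y ^ l ∈ K := by
    intro y hy
    refine ⟨(⟨y, hy⟩ : (curveχq p i j).DeltaHat) ^ l, ?_, rfl⟩
    rw [SetLike.mem_coe, MonoidHom.mem_ker, map_pow]
    generalize ψ ⟨y, hy⟩ = z
    rw [← ofAdd_toAdd z, ← ofAdd_nsmul, nsmul_eq_mul, show ((l : ℕ) : ZMod L) = 0 from ZMod.natCast_self L,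
      zero_mul, ofAdd_zero]
  have hbK := (ClassTwoBar.barThetaOf_le_of_isClosed _ l (deltaHatχq_normal p i j) hK h1 h2) hb
  obtain ⟨-, h⟩ := (hmem _).1 hbK
  rw [SemidirectProduct.left_inl, eHatB_eta, expB_of_one, iotaZ_one_eq, ZHatLevel.level_eta] at h
  haveI : Nontrivial (ZMod (L : ℕ)) := ZMod.nontrivial_iff.mpr (show l ≠ 1 by omega)
  have h1' : ((1 : ℤ) : ZMod (L : ℕ)) = 0 := Multiplicative.ofAdd.injective (h.trans ofAdd_zero.symm)
  rw [Int.cast_one] at h1'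
  exact one_ne_zero h1'

/-- `b = inl(η b) ∈ toHat(I_x)` at the stage-2 cusp datum (`I_x = inl(b^Ẑ)`). [cite: MochizukiSemiAnbd2006, §6 p.71] -/
theorem inl_eta_one_mem_map_inertia_χq (x : (curveχq' p i j).Pt) :
    (SemidirectProduct.inl (eta (FreeGroup.of 1)) : PiHtχq p i j) ∈
      ((curveχq' p i j).inertia x).map (curveχq' p i j).toHat.toMonoidHom := by
  rw [inertia_curveχq'_eq]
  refine ⟨SemidirectProduct.inl (bPowGfp (iotaZ (Multiplicative.ofAdd 1))), ⟨_, bPowGfp_mem_bAxisGfp _, rfl⟩, ?_⟩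
  change toHatχq p i j (SemidirectProduct.inl (bPowGfp (iotaZ (Multiplicative.ofAdd 1)))) = _
  refine SemidirectProduct.ext ?_ rfl
  rw [toHatχq_left, SemidirectProduct.left_inl, SemidirectProduct.left_inl, gfpFst_apply, coe_bPowGfp,
    bPow_iotaZ_one]

/-- **The inertia clause FAILS at the stage-2 cusp datum `curveχq′` for every `l ≥ 2`** (the synthetic inertia
`b^Ẑ` maps non-trivially to `Δ̄^ell_X`; hence `toHat(I_x) ≰ barThetaOf Δ̂ l`, a fortiori the §1-side clause of hIx
fails). [cite: MochizukiEtTh2009, Def 2.1 p.35] -/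
theorem not_inertiaClause_curveχq' (l : ℕ) (hl : 2 ≤ l) (x : (curveχq' p i j).Pt) :
    ¬ (((curveχq' p i j).inertia x).map (curveχq' p i j).toHat.toMonoidHom ⊔
        ClassTwoBar.barKerOf (curveχq' p i j).DeltaHat l = ClassTwoBar.barThetaOf (curveχq' p i j).DeltaHat l) := by
  intro h
  have hle : ((curveχq' p i j).inertia x).map (curveχq' p i j).toHat.toMonoidHom ≤
      ClassTwoBar.barThetaOf (curveχq' p i j).DeltaHat l := le_sup_left.trans h.le
  rw [curveχq'_deltaHat] at hle
  exact inl_eta_one_not_mem_barThetaOf_χq p i j l hl (hle (inl_eta_one_mem_map_inertia_χq p i j x))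

/-- Census summary at stage 2: the cusp of `curveχq′` EXISTS with inertia `≅ Ẑ`, (R1e′) HOLDS for `inversionχq`,
and the inertia clause FAILS for every `l ≥ 2`. [cite: MochizukiEtTh2009, Def 2.1 p.35] -/
theorem stageTwo_census (l : ℕ) (hl : 2 ≤ l) :
    (∀ g ∈ (curveχq' p i j).DeltaHat,
      (curveχq' p i j).completionAut (inversionχq p i j) g * g ∈
        (⁅(curveχq' p i j).DeltaHat, (curveχq' p i j).DeltaHat⁆).topologicalClosure) ∧
    ∃ x : (curveχq' p i j).Pt, (curveχq' p i j).IsCusp x ∧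
      Nonempty (↥((curveχq' p i j).decomp x ⊓ (curveχq' p i j).aug.toMonoidHom.ker) ≃ₜ* ZHat) ∧
      ¬ (((curveχq' p i j).inertia x).map (curveχq' p i j).toHat.toMonoidHom ⊔
          ClassTwoBar.barKerOf (curveχq' p i j).DeltaHat l = ClassTwoBar.barThetaOf (curveχq' p i j).DeltaHat l) :=
  ⟨inversionχq_hinv' p i j,
    ⟨(), trivial, (curveχq' p i j).inertia_equiv_zHat () trivial, not_inertiaClause_curveχq' p i j l hl ()⟩⟩

end Literature.AnabelianGeometry.EtaleTheta.SettingModel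

end
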